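import Summits.ValiantsHypothesis.ValiantsHypothesis.Theorems.LacunarySymmetroidMatrixDescartesStampFull013578

/-!
# `MatrixDescartes` — register reading of G6 (`FullyRealisable 2 dA5 16`) in stamp-row currency: `ν(2,6) ≥ 16`

HONEST FRAMING.  Object-search cell `pub-symmetroid`, seat val-sym-engine-7 (certificate engine, 18050 B⁻ register).  HELPER of the
crux item `stmt-ValiantsHypothesis-18050` (`…Theses.LacunarySymmetroid.MatrixDescartes`, asymptotic in `K`) with NO closure claim.
One one-line reading of the landed G6 certificate `FiniteSector.fullyRealisable_two_013578_16` (`…StampFull013578`, p609049) in the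
stamp-row currency of `…FiniteSectorDefs`: `not_stampLawAt_two_six_15 : ¬ StampLawAt 2 6 15` — the stamp row «`ν(2,6) ≤ 15`» is false,
i.e. `ν(2,6) ≥ 16 = n(2,5)` (and `≤ 16` by the postage-stamp ceiling `mem_sumset_of_fullPos`, not restated here).  The η-reading
«`η(2,6) ≥ 32`» (doubling, line «finite» F7 ≡ G6) is `FiniteSector.not_hypRootLawAt_two_six_31` of `…FiniteSectorEtaTwoSix`
(val-sym-door-p5 g7, writer of record per desk pub-symmetroid R2483) and is NOT restated here.
Nothing here bears on the crux, on DoorA26 / DoorA34, or on `VP ≠ VNP`.  [folklore] bookkeeping; no citation exists or is needed.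
-/

-- `Summit.ValiantsHypothesis.ValiantsHypothesis.…` repeats a component by the D-0017 layout
-- (single-conjunct summit), which the `dupNamespace` linter flags; the name is mandated.
set_option linter.dupNamespace false

namespace Summit.ValiantsHypothesis.ValiantsHypothesis.Theorems.LacunarySymmetroidMatrixDescartes.FiniteSector

open scoped BigOperators Matrix
open Polynomial

/-- **`ν(2,6) ≥ 16`**: the stamp row `StampLawAt 2 6 15` fails (witness: the G6 half-pencil on `(0,1,3,5,7,8)`, degree `16`,
`16` distinct positive roots). [folklore] -/
theorem not_stampLawAt_two_six_15 : ¬ StampLawAt 2 6 15 := by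
  intro h
  obtain ⟨S, hS, hfull, hdeg⟩ := fullyRealisable_two_013578_16
  have h16 := h _ S hS hfull
  rw [hdeg] at h16
  exact absurd h16 (by norm_num)

end Summit.ValiantsHypothesis.ValiantsHypothesis.Theorems.LacunarySymmetroidMatrixDescartes.FiniteSector
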